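import Summits.ABC.IUTFork.Cor312Chain
import Summits.ABC.IUTFork.LanaRss
import HarnessLib

/-!
# [IUTchIII] Corollary 3.12 — readings of the edge, III: LANA's (9-1) at measure level (c312 crew, V-c)

Record-only file (D-0012) of the abc-iut cell; TAKES NO SIDE. `Cor312Chain.lean` isolates the content of the
printed proof of [IUTchIII] Cor. 3.12 beyond its cited loci and qualitative observations in the named edge
`RealEdges.inclusion` ((xi-f) "then follows formally"). LANA's position [cite: LANA2026Report, §9 p. 44,
§9.2 (9-1) p. 46, §10.5 p. 49] is that the inequality "hinges on the compatibility (9-1)". The crew's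
c312-4 has typed (9-1) AS PRINTED over a Mathlib measure space (`LanaRss.lean`, p404086: regions of a measure
space modulo equal volume = `ℝ^ss`, the pointed-line isomorphisms `η`, `EtaData.MainGoal`, and
`EtaData.cor312_of_mainGoal`: (9-1) + "every suitable `LGP·S` lies in the hull" ⟹ `−|log(q)| ≤ −|log(Θ)|`
by monotonicity of the measure). This file is the one-line bridge: (9-1) at measure level gives the chain's
real edges OUTRIGHT, for every reading `O` of the proof's observations (`realEdges_of_lanaMainGoal`) — the
chain is not used; what LANA "do not have a proof of" is (9-1) itself. (The region-level form over skel
XVII `ForkRegions` is the sibling V-b `Cor312EdgeRegions.lean`; kept separate while skel `ForkEta` and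
`LanaRss` both declare `Summit.ABC.IUTFork.Rss`.) Nothing new is claimed; nothing is asserted.
-/

noncomputable section

namespace Summit.ABC

namespace IUTFork

namespace Cor312Proof

open MeasureTheory

variable {Ω : Type} [MeasurableSpace Ω] {μ : Measure Ω}

/-- The chain's `Volumes` of c312-4's measure-level `η`-data (`LanaRss.EtaData`: `−|log(q)| := log μ(q-region)`,
`−|log(Θ)| := log μ(hull)`), with "`|log(q)| > 0`" as the hypothesis `hq`. [cite: LANA2026Report, §9.2 p. 46] -/
def Volumes.ofEtaData (E : EtaData μ) (hq : E.negAbsLogq < 0) : Volumes where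
  negLogTheta := (E.negAbsLogTheta : WithTop ℝ)
  negAbsLogq := E.negAbsLogq
  negAbsLogq_neg := hq

/-- … finite, and its `Cor312` is c312-4's measure-level inequality `−|log(q)| ≤ −|log(Θ)|`. [folklore] -/
theorem Volumes.ofEtaData_cor312_iff (E : EtaData μ) (hq : E.negAbsLogq < 0) :
    (Volumes.ofEtaData E hq).Cor312 ↔ E.negAbsLogq ≤ E.negAbsLogTheta := by
  simp only [Volumes.Cor312, Volumes.Finite, Volumes.ofEtaData, ne_eq, WithTop.coe_ne_top, not_false_eq_true,
    true_and, WithTop.coe_le_coe]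

/-- **(9-1) as printed ⟹ the real edges, for every reading of the proof's observations** — via c312-4's
`EtaData.cor312_of_mainGoal`, granted that every suitable `LGP·S` lies in the hull (LANA §8.1 (f): the hull
is taken of the union of the possible images). LANA p. 44: "if the problem described in the "main goal"
below is solved, then Corollary 3.12 … will follow" — a theorem at this level of typing; "(9-1) … is not
manifestly false. However, we … do not have a proof of (9-1) at this time" (§10.5 p. 49).
[cite: LANA2026Report, §9 p. 44, §9.2 (9-1) p. 46] -/
theorem realEdges_of_lanaMainGoal (E : EtaData μ) (hq : E.negAbsLogq < 0)
    (hsub : ∀ S ∈ E.Suitable, (E.LGP S).carrier ⊆ E.hull.carrier) (h : E.MainGoal) (O : Obs → Prop) :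
    RealEdges O (Volumes.ofEtaData E hq) :=
  ⟨WithTop.coe_ne_top, fun _ => WithTop.coe_le_coe.2 (E.cor312_of_mainGoal hsub h)⟩

/-- … and, composed with the chain under any grant of the loci: loci ∧ chain ∧ (9-1) ⟹ Cor. 3.12 for the
measure-level data (the chain is idle here — recorded to make that visible). [cite: LANA2026Report, §9 p. 44] -/
theorem cor312_of_chain_of_lanaMainGoal (E : EtaData μ) (hq : E.negAbsLogq < 0)
    (hsub : ∀ S ∈ E.Suitable, (E.LGP S).carrier ⊆ E.hull.carrier) (h : E.MainGoal)
    {L : Locus → Prop} {O : Obs → Prop} (hL : ∀ c, L c) (hC : Chain L O) : (Volumes.ofEtaData E hq).Cor312 :=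
  cor312_of_chain hL hC (realEdges_of_lanaMainGoal E hq hsub h O)

end Cor312Proof

end IUTFork

end Summit.ABC

end
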